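import Mathlib
import Summits.ValiantsHypothesis.ValiantsHypothesis.Theses.LiouvilleSarnak
import Summits.ValiantsHypothesis.ValiantsHypothesis.Theorems.LiouvilleSarnakLiouvilleCutRankOneBlock
import Summits.ValiantsHypothesis.ValiantsHypothesis.Theorems.LiouvilleSarnakLiouvilleCutRankSignPatternsTools

/-!
# Route LiouvilleSarnak — crux `LiouvilleCutRank` (stmt-ValiantsHypothesis-14775):
# SIGN PATTERNS OF `λ` (Chowla's pattern consequence) ⇒ the crux

`Theorems/LiouvilleSarnakLiouvilleCutRankOneBlock.lean` reduced the crux `LiouvilleCutRank` to its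
ONE-BLOCK form (one rich aligned block of `λ` per cut word at one scale), and
`Theorems/LiouvilleSarnakLiouvilleCutRankSignPatternsTools.lean` shows that the sign-pattern hypothesis

  `(SP)  every finite sign pattern occurs in λ:  ∀ k, ∀ p : Fin k → Bool, ∃ m, ∀ i < k, λ(m + i + 1) = ±1 according to p i`

(implied by Chowla's conjecture; known for `k ≤ 3`, Matomäki–Radziwiłł–Tao) supplies such a block for
every cut word (`SignPatterns.exists_block_rank_ge_of_signPatterns`).  Hence ★
`liouvilleCutRank_of_signPatterns : (SP) → LiouvilleCutRank`: the crux sits BELOW Chowla.  The plain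
crux (all cuts at all large levels — the initial segments `λ|[1, 4^n]`) gets nothing from `(SP)`, which
does not say WHERE a pattern occurs; the `∃ H` of the one-block form is exactly what makes it usable.

Honest framing: a CONDITIONAL placement (`(SP)` is open and Chowla-strength; it is a hypothesis written
inline, not a Literature fact and not a claim); `LiouvilleCutRank`, `DigitalBilinearLiouville` and
`AlgebraicSarnak` stay OPEN, and nothing here bears on VP versus VNP.  No definitions.
-/

-- the directory `ValiantsHypothesis/ValiantsHypothesis` repeats the summit name (tree layout)
set_option linter.dupNamespace false

namespace Summit.ValiantsHypothesis.ValiantsHypothesis.Theorems.LiouvilleSarnakLiouvilleCutRank.SignPatterns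

open ArithmeticFunction

open Summit.ValiantsHypothesis.ValiantsHypothesis.Theses.LiouvilleSarnak (LiouvilleCutRank)
open Summit.ValiantsHypothesis.ValiantsHypothesis.Theorems.LiouvilleSarnakLiouvilleCutRank.OneBlock
  (liouvilleCutRank_of_oneBlock)

/-- ★ **Sign patterns ⇒ `LiouvilleCutRank`.**  If every finite sign pattern occurs in the Liouville
sequence (the pattern consequence of Chowla's conjecture), then the crux `LiouvilleCutRank` holds: the
one-block form (`OneBlock.liouvilleCutRank_of_oneBlock`) at scale `n₁ = 2W + 2`, fed by
`exists_block_rank_ge_of_signPatterns`. [folklore] -/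
theorem liouvilleCutRank_of_signPatterns
    (hpat : ∀ k : ℕ, ∀ p : Fin k → Bool, ∃ m : ℕ, ∀ i : Fin k,
      liouville (m + i + 1) = if p i then 1 else -1) :
    LiouvilleCutRank :=
  liouvilleCutRank_of_oneBlock fun W => ⟨2 * W + 2, exists_block_rank_ge_of_signPatterns hpat W⟩

end Summit.ValiantsHypothesis.ValiantsHypothesis.Theorems.LiouvilleSarnakLiouvilleCutRank.SignPatterns
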